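import Summits.QuantumFields.BalabanUV.Beta.GAN24.ArrowAnchorRealCap

/-!
# `BalabanUV.Beta.GAN24.ArrowAnchorRealCapRadius` — binder row G-an2-4 / (CONV-C), road P1-fibre, p1 row **P1-L10** `FibreStrip` ((I3′)), leaf-16's cut (M4)
# `L10-CUT-M4.md` row **F5 `ArrowAnchorReal`** (OUTER ANCHOR), PREP PART (iii′): the outer-scaled inverse capacitance for a GENERAL OUTER RADIUS
# `r₀ ≥ (2/π)|q|₂` — in particular F1c's `radO N q 0 = N·√(lapR (kfine N q 0))`

NOT IN PRINT; OUR PROOF ATTEMPT.  HONEST FRAMING (cell contract, verbatim): «discharging `BetaPertH` makes Bałaban's UV stability UNCONDITIONAL — a real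
constructive-QFT result; it is NOT the continuum limit and NOT the Clay problem.»  HONEST DEPENDENCY (verbatim): «continuum YM on T⁴ ⇐ BetaPertH ∧ nine spine
estimates (0/9 proved); BetaPertH ⇐ (D1) ∧ (D4) ∧ CAP+tail; G-an2-4 gates asym, D1 and NE2/3/4.»  [folklore] bookkeeping over `GAN24/ArrowAnchorRealCap`
(this lineage, p202858), `GAN24/CapacitanceEndpoint` (leaf-20, L08) and leaf-12's `CapacitanceScalarBounds.le_sq_mul_lapR_zero` — every input BY NAME; no
cited fact, no wall binder, no `def … : Prop`; the `def`s are scaling data + one displayed constant.  NOT summit progress: nothing of (CONV-C)'s K-slot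
`GAN24.CombesThomas.ConvCK 3 Lc` is discharged here; 0 wall binders; NOT `BetaPertH`, NOT continuum, NOT Clay.

## Why (leaf-16-g6's F1c spec, CLAIMS l.3224 (C))
F1c fixes the OUTER radius of the zero alias as `r₀ := radO N q 0 = N·√(lapR (kfine N q 0)) = √(N²L₀)` — not `|q|₂` — so that the scaled zero block is the
UNIT KKT block.  Since `(4/π²)|q|² ≤ N²L₀ ≤ |q|²` (`le_sq_mul_lapR_zero`, `sq_mul_lapR_zero_le`), this radius satisfies `(2/π)|q|₂ ≤ r₀ ≤ |q|₂`; ONLY THE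
LOWER BOUND is needed below.

## What is proved (every `D`, `N ≥ 1`, `q ∈ [−π, π]^D ∖ {0}`, any `r₀` with `(2/π)·|q|₂ ≤ r₀`)
* `capSR N q r₀ := diagonal rowScaleR · cap N (ofRealVec q) · diagonal colScaleR` with `rowScaleR = (N^{−(D+1)} on Q, r₀/N^{D+1} on M)`,
  `colScaleR = (r₀²/N³ on φ, r₀³/N³ on c)`; `isUnit_capSR`, `capSR_inv` (explicit), `capSR_inv_apply`;
* ENTRYWISE: `φφ ≤ (π/2)²·cPP D`, `φc, cφ ≤ (π/2)³·cPc D`, `cc ≤ (π/2)⁴·ccc D` (the A4′(iii) orders `|q|², |q|³, |q|³, |q|⁴ /N^{D+4}` against `r₀ ≥ (2/π)|q|₂`);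
* **`norm_capSR_inv_le : ‖(capSR N q r₀)⁻¹‖ ≤ bCapO D`**, `bCapO D = (π/2)²D²·cPP D + 2(π/2)³D·cPc D + (π/2)⁴·ccc D`; packaged `capSR_ape`;
* **`capSR_ape_radO`**: the instance `r₀ = N·√(lapR (kfine N q 0))` (`two_div_pi_mul_rad_le_radO`).
Consumer: F5 proper feeds `bCapO` as the `b` of F1b `ArrowNorms.isUnit_bordered` for `outerArrow N q (ofRealVec q)` once F1c identifies its Schur complement
`ArrowNorms.capS` with `±capSR N q (radO N q 0)`.
Unit `b2b-balaban-gan24-formalise-leaf-12` (G-an2-4 formalisation swarm, leaf prover 12, gen 7), 2026-08-20.  Value = kernel bookkeeping toward (I3′), NOT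
summit progress.
-/

noncomputable section

open Complex Finset Matrix
open scoped BigOperators Real Matrix.Norms.L2Operator

namespace Summit.QuantumFields.BalabanUV.Beta.GAN24.ArrowAnchorRealCapRadius

open Literature.MathematicalPhysics.QuantumFieldTheory.Balaban1983to89.B4Strip (ofRealVec)
open Literature.MathematicalPhysics.QuantumFieldTheory.King1986 (momSq momSq_nonneg)
open AliasObjects (cap)
open AliasWeights (kfine)
open AliasWeightsSum (lapR lapR_nonneg)
open CapacitanceScalarBounds (momSq_pos le_sq_mul_lapR_zero)
open CapacitanceEndpointBlocks (cPP cPc ccc cPP_pos cPc_pos ccc_pos)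
open CapacitanceEndpoint (isUnit_cap_det_ofRealVec norm_cap_inv_inl_inl_le norm_cap_inv_inl_inr_le norm_cap_inv_inr_inl_le norm_cap_inv_inr_inr_le)
open BorderedFrameInverseBlocks (opNorm_le_sum_entries)
open ArrowAnchorRealCap (rad rad_nonneg rad_sq rad_pos rad_pow_three rad_pow_four)

variable {D : ℕ}

/-! ## §1 Scalings with a general outer radius -/

/-- Row scaling with outer radius `r₀`: `Q_κ ↦ N^{−(D+1)}`, `M ↦ r₀/N^{D+1}`. -/
def rowScaleR (N : ℕ) (r0 : ℝ) : Fin D ⊕ Unit → ℝ :=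
  Sum.elim (fun _ => ((N : ℝ) ^ (D + 1))⁻¹) (fun _ => r0 / (N : ℝ) ^ (D + 1))

/-- Column scaling with outer radius `r₀`: `φ_κ ↦ r₀²/N³`, `c ↦ r₀³/N³`. -/
def colScaleR (N : ℕ) (r0 : ℝ) : Fin D ⊕ Unit → ℝ :=
  Sum.elim (fun _ => r0 ^ 2 / (N : ℝ) ^ 3) (fun _ => r0 ^ 3 / (N : ℝ) ^ 3)

/-- [folklore] Unfolding: `Q`-row scale. -/
@[simp] theorem rowScaleR_inl (N : ℕ) (r0 : ℝ) (κ : Fin D) : rowScaleR (D := D) N r0 (Sum.inl κ) = ((N : ℝ) ^ (D + 1))⁻¹ := rfl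
/-- [folklore] Unfolding: `M`-row scale. -/
@[simp] theorem rowScaleR_inr (N : ℕ) (r0 : ℝ) (u : Unit) : rowScaleR (D := D) N r0 (Sum.inr u) = r0 / (N : ℝ) ^ (D + 1) := rfl
/-- [folklore] Unfolding: `φ`-column scale. -/
@[simp] theorem colScaleR_inl (N : ℕ) (r0 : ℝ) (κ : Fin D) : colScaleR (D := D) N r0 (Sum.inl κ) = r0 ^ 2 / (N : ℝ) ^ 3 := rfl
/-- [folklore] Unfolding: `c`-column scale. -/
@[simp] theorem colScaleR_inr (N : ℕ) (r0 : ℝ) (u : Unit) : colScaleR (D := D) N r0 (Sum.inr u) = r0 ^ 3 / (N : ℝ) ^ 3 := rfl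

/-- [folklore] Row scales are positive (`N ≥ 1`, `r₀ > 0`). -/
theorem rowScaleR_pos {N : ℕ} (hN : 1 ≤ N) {r0 : ℝ} (hr : 0 < r0) (i : Fin D ⊕ Unit) : 0 < rowScaleR (D := D) N r0 i := by
  have hN0 : (0 : ℝ) < N := by exact_mod_cast hN
  rcases i with κ | u
  · rw [rowScaleR_inl]; positivity
  · rw [rowScaleR_inr]; positivity

/-- [folklore] Column scales are positive (`N ≥ 1`, `r₀ > 0`). -/
theorem colScaleR_pos {N : ℕ} (hN : 1 ≤ N) {r0 : ℝ} (hr : 0 < r0) (j : Fin D ⊕ Unit) : 0 < colScaleR (D := D) N r0 j := by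
  have hN0 : (0 : ℝ) < N := by exact_mod_cast hN
  rcases j with κ | u
  · rw [colScaleR_inl]; positivity
  · rw [colScaleR_inr]; positivity

/-- [folklore] A radius above `(2/π)|q|₂` is positive for `q ≠ 0`. -/
theorem radius_pos {q : Fin D → ℝ} (hq0 : q ≠ 0) {r0 : ℝ} (hr0 : 2 / π * rad q ≤ r0) : 0 < r0 :=
  lt_of_lt_of_le (mul_pos (div_pos two_pos Real.pi_pos) (rad_pos hq0)) hr0

/-- [folklore] The key ratio: `|q|₂/r₀ ≤ π/2`, i.e. `rad q ≤ (π/2)·r₀`. -/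
theorem rad_le {q : Fin D → ℝ} {r0 : ℝ} (hr0 : 2 / π * rad q ≤ r0) : rad q ≤ π / 2 * r0 := by
  have hπ := Real.pi_pos
  have h := mul_le_mul_of_nonneg_left hr0 (by positivity : (0 : ℝ) ≤ π / 2)
  calc rad q = π / 2 * (2 / π * rad q) := by field_simp
    _ ≤ π / 2 * r0 := h

/-! ## §2 The generally-scaled capacitance and its explicit inverse -/

/-- **THE OUTER-SCALED CAPACITANCE WITH RADIUS `r₀`**: `capSR N q r₀ = diagonal rowScaleR · cap N (ofRealVec q) · diagonal colScaleR`. -/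
def capSR (N : ℕ) [NeZero N] (q : Fin D → ℝ) (r0 : ℝ) : Matrix (Fin D ⊕ Unit) (Fin D ⊕ Unit) ℂ :=
  diagonal (fun i => ((rowScaleR (D := D) N r0 i : ℝ) : ℂ)) * cap N (ofRealVec q) * diagonal (fun j => ((colScaleR (D := D) N r0 j : ℝ) : ℂ))

/-- The candidate inverse `diagonal colScaleR⁻¹ · (cap N p)⁻¹ · diagonal rowScaleR⁻¹`. -/
def capSRInv (N : ℕ) [NeZero N] (q : Fin D → ℝ) (r0 : ℝ) : Matrix (Fin D ⊕ Unit) (Fin D ⊕ Unit) ℂ :=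
  diagonal (fun i => (((colScaleR (D := D) N r0 i)⁻¹ : ℝ) : ℂ)) * (cap N (ofRealVec q))⁻¹ *
    diagonal (fun j => (((rowScaleR (D := D) N r0 j)⁻¹ : ℝ) : ℂ))

variable {N : ℕ} [NeZero N] {q : Fin D → ℝ} {r0 : ℝ}

/-- [folklore] `capSR · capSRInv = 1`. -/
theorem capSR_mul_capSRInv (hN : 1 ≤ N) (hq : ∀ i, |q i| ≤ π) (hq0 : q ≠ 0) (hr : 0 < r0) :
    capSR N q r0 * capSRInv N q r0 = 1 := by
  have hdet := isUnit_cap_det_ofRealVec (D := D) (N := N) hN hq hq0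
  have hc : ∀ j, ((colScaleR (D := D) N r0 j : ℝ) : ℂ) * (((colScaleR (D := D) N r0 j)⁻¹ : ℝ) : ℂ) = 1 := fun j => by
    rw [← Complex.ofReal_mul, mul_inv_cancel₀ (colScaleR_pos hN hr j).ne', Complex.ofReal_one]
  have hrw : ∀ i, ((rowScaleR (D := D) N r0 i : ℝ) : ℂ) * (((rowScaleR (D := D) N r0 i)⁻¹ : ℝ) : ℂ) = 1 := fun i => by
    rw [← Complex.ofReal_mul, mul_inv_cancel₀ (rowScaleR_pos hN hr i).ne', Complex.ofReal_one]
  unfold capSR capSRInv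
  calc diagonal (fun i => ((rowScaleR (D := D) N r0 i : ℝ) : ℂ)) * cap N (ofRealVec q) * diagonal (fun j => ((colScaleR (D := D) N r0 j : ℝ) : ℂ)) *
        (diagonal (fun i => (((colScaleR (D := D) N r0 i)⁻¹ : ℝ) : ℂ)) * (cap N (ofRealVec q))⁻¹ *
          diagonal (fun j => (((rowScaleR (D := D) N r0 j)⁻¹ : ℝ) : ℂ)))
      = diagonal (fun i => ((rowScaleR (D := D) N r0 i : ℝ) : ℂ)) * (cap N (ofRealVec q) *
          ((diagonal (fun j => ((colScaleR (D := D) N r0 j : ℝ) : ℂ)) * diagonal (fun i => (((colScaleR (D := D) N r0 i)⁻¹ : ℝ) : ℂ))) *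
            (cap N (ofRealVec q))⁻¹)) * diagonal (fun j => (((rowScaleR (D := D) N r0 j)⁻¹ : ℝ) : ℂ)) := by
        simp only [Matrix.mul_assoc]
    _ = 1 := by
        rw [diagonal_mul_diagonal, show (fun i => ((colScaleR (D := D) N r0 i : ℝ) : ℂ) * (((colScaleR (D := D) N r0 i)⁻¹ : ℝ) : ℂ)) = fun _ => 1
            from funext hc, diagonal_one, Matrix.one_mul, Matrix.mul_nonsing_inv _ hdet, Matrix.mul_one, diagonal_mul_diagonal,
          show (fun i => ((rowScaleR (D := D) N r0 i : ℝ) : ℂ) * (((rowScaleR (D := D) N r0 i)⁻¹ : ℝ) : ℂ)) = fun _ => 1 from funext hrw, diagonal_one]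

/-- [folklore] **`capSR` IS INVERTIBLE** (`N ≥ 1`, `q ∈ [−π,π]^D ∖ {0}`, `r₀ > 0`). -/
theorem isUnit_capSR (hN : 1 ≤ N) (hq : ∀ i, |q i| ≤ π) (hq0 : q ≠ 0) (hr : 0 < r0) : IsUnit (capSR N q r0) := by
  have h := capSR_mul_capSRInv hN hq hq0 hr
  have hdet : IsUnit (capSR N q r0).det :=
    IsUnit.of_mul_eq_one (capSRInv N q r0).det (by rw [← Matrix.det_mul, h, Matrix.det_one])
  exact (Matrix.isUnit_iff_isUnit_det _).mpr hdet

/-- [folklore] **THE EXPLICIT INVERSE** `(capSR N q r₀)⁻¹ = capSRInv N q r₀`. -/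
theorem capSR_inv (hN : 1 ≤ N) (hq : ∀ i, |q i| ≤ π) (hq0 : q ≠ 0) (hr : 0 < r0) : (capSR N q r0)⁻¹ = capSRInv N q r0 :=
  Matrix.inv_eq_right_inv (capSR_mul_capSRInv hN hq hq0 hr)

/-- [folklore] Norm of an inverse entry: `‖(capSR⁻¹) i j‖ = colScaleR(i)⁻¹ · ‖(cap⁻¹) i j‖ · rowScaleR(j)⁻¹`. -/
theorem norm_capSR_inv_apply (hN : 1 ≤ N) (hq : ∀ i, |q i| ≤ π) (hq0 : q ≠ 0) (hr : 0 < r0) (i j : Fin D ⊕ Unit) :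
    ‖(capSR N q r0)⁻¹ i j‖ = (colScaleR (D := D) N r0 i)⁻¹ * ‖(cap N (ofRealVec q))⁻¹ i j‖ * (rowScaleR (D := D) N r0 j)⁻¹ := by
  rw [capSR_inv hN hq hq0 hr]
  unfold capSRInv
  rw [mul_diagonal, diagonal_mul, norm_mul, norm_mul, Complex.norm_real, Complex.norm_real,
    Real.norm_of_nonneg (inv_nonneg.2 (colScaleR_pos hN hr i).le), Real.norm_of_nonneg (inv_nonneg.2 (rowScaleR_pos hN hr j).le)]

/-! ## §3 The four blocks against a radius `r₀ ≥ (2/π)|q|₂` -/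

/-- **`φφ`**: `‖(capSR⁻¹) (inl κ) (inl l)‖ ≤ (π/2)²·cPP D` (`= cPP·|q|²/r₀²`). [folklore] -/
theorem norm_capSR_inv_inl_inl_le (hN : 1 ≤ N) (hq : ∀ i, |q i| ≤ π) (hq0 : q ≠ 0) (hr0 : 2 / π * rad q ≤ r0) (κ l : Fin D) :
    ‖(capSR N q r0)⁻¹ (Sum.inl κ) (Sum.inl l)‖ ≤ (π / 2) ^ 2 * cPP D := by
  have hN0 : (0 : ℝ) < N := by exact_mod_cast hN
  have hr := radius_pos hq0 hr0
  have hρ := rad_le hr0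
  have hP := (cPP_pos D).le
  rw [norm_capSR_inv_apply hN hq hq0 hr, colScaleR_inl, rowScaleR_inl, inv_inv]
  have h := norm_cap_inv_inl_inl_le (D := D) (N := N) hN hq hq0 κ l
  rw [← rad_sq] at h
  calc (r0 ^ 2 / (N : ℝ) ^ 3)⁻¹ * ‖(cap N (ofRealVec q))⁻¹ (Sum.inl κ) (Sum.inl l)‖ * (N : ℝ) ^ (D + 1)
      ≤ (r0 ^ 2 / (N : ℝ) ^ 3)⁻¹ * (cPP D * rad q ^ 2 / (N : ℝ) ^ (D + 4)) * (N : ℝ) ^ (D + 1) :=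
        mul_le_mul_of_nonneg_right (mul_le_mul_of_nonneg_left h (by positivity)) (by positivity)
    _ = cPP D * (rad q / r0) ^ 2 := by field_simp; ring
    _ ≤ cPP D * (π / 2) ^ 2 := by
        apply mul_le_mul_of_nonneg_left _ hP
        exact pow_le_pow_left₀ (div_nonneg (rad_nonneg q) hr.le) (by rw [div_le_iff₀ hr]; exact hρ) 2
    _ = (π / 2) ^ 2 * cPP D := by ring

/-- **`φc`**: `‖(capSR⁻¹) (inl κ) (inr u)‖ ≤ (π/2)³·cPc D` (`= cPc·|q|³/r₀³`). [folklore] -/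
theorem norm_capSR_inv_inl_inr_le (hN : 1 ≤ N) (hq : ∀ i, |q i| ≤ π) (hq0 : q ≠ 0) (hr0 : 2 / π * rad q ≤ r0) (κ : Fin D) (u : Unit) :
    ‖(capSR N q r0)⁻¹ (Sum.inl κ) (Sum.inr u)‖ ≤ (π / 2) ^ 3 * cPc D := by
  have hN0 : (0 : ℝ) < N := by exact_mod_cast hN
  have hr := radius_pos hq0 hr0
  have hρ := rad_le hr0
  have hP := (cPc_pos D).le
  rw [norm_capSR_inv_apply hN hq hq0 hr, colScaleR_inl, rowScaleR_inr]
  have h := norm_cap_inv_inl_inr_le (D := D) (N := N) hN hq hq0 κ u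
  rw [← rad_pow_three] at h
  calc (r0 ^ 2 / (N : ℝ) ^ 3)⁻¹ * ‖(cap N (ofRealVec q))⁻¹ (Sum.inl κ) (Sum.inr u)‖ * (r0 / (N : ℝ) ^ (D + 1))⁻¹
      ≤ (r0 ^ 2 / (N : ℝ) ^ 3)⁻¹ * (cPc D * rad q ^ 3 / (N : ℝ) ^ (D + 4)) * (r0 / (N : ℝ) ^ (D + 1))⁻¹ :=
        mul_le_mul_of_nonneg_right (mul_le_mul_of_nonneg_left h (by positivity)) (by positivity)
    _ = cPc D * (rad q / r0) ^ 3 := by field_simp; ring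
    _ ≤ cPc D * (π / 2) ^ 3 := by
        apply mul_le_mul_of_nonneg_left _ hP
        exact pow_le_pow_left₀ (div_nonneg (rad_nonneg q) hr.le) (by rw [div_le_iff₀ hr]; exact hρ) 3
    _ = (π / 2) ^ 3 * cPc D := by ring

/-- **`cφ`**: `‖(capSR⁻¹) (inr u) (inl l)‖ ≤ (π/2)³·cPc D`. [folklore] -/
theorem norm_capSR_inv_inr_inl_le (hN : 1 ≤ N) (hq : ∀ i, |q i| ≤ π) (hq0 : q ≠ 0) (hr0 : 2 / π * rad q ≤ r0) (u : Unit) (l : Fin D) :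
    ‖(capSR N q r0)⁻¹ (Sum.inr u) (Sum.inl l)‖ ≤ (π / 2) ^ 3 * cPc D := by
  have hN0 : (0 : ℝ) < N := by exact_mod_cast hN
  have hr := radius_pos hq0 hr0
  have hρ := rad_le hr0
  have hP := (cPc_pos D).le
  rw [norm_capSR_inv_apply hN hq hq0 hr, colScaleR_inr, rowScaleR_inl, inv_inv]
  have h := norm_cap_inv_inr_inl_le (D := D) (N := N) hN hq hq0 u l
  rw [← rad_pow_three] at h
  calc (r0 ^ 3 / (N : ℝ) ^ 3)⁻¹ * ‖(cap N (ofRealVec q))⁻¹ (Sum.inr u) (Sum.inl l)‖ * (N : ℝ) ^ (D + 1)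
      ≤ (r0 ^ 3 / (N : ℝ) ^ 3)⁻¹ * (cPc D * rad q ^ 3 / (N : ℝ) ^ (D + 4)) * (N : ℝ) ^ (D + 1) :=
        mul_le_mul_of_nonneg_right (mul_le_mul_of_nonneg_left h (by positivity)) (by positivity)
    _ = cPc D * (rad q / r0) ^ 3 := by field_simp; ring
    _ ≤ cPc D * (π / 2) ^ 3 := by
        apply mul_le_mul_of_nonneg_left _ hP
        exact pow_le_pow_left₀ (div_nonneg (rad_nonneg q) hr.le) (by rw [div_le_iff₀ hr]; exact hρ) 3
    _ = (π / 2) ^ 3 * cPc D := by ring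

/-- **`cc`**: `‖(capSR⁻¹) (inr u) (inr u')‖ ≤ (π/2)⁴·ccc D` (`= ccc·|q|⁴/r₀⁴`). [folklore] -/
theorem norm_capSR_inv_inr_inr_le (hN : 1 ≤ N) (hq : ∀ i, |q i| ≤ π) (hq0 : q ≠ 0) (hr0 : 2 / π * rad q ≤ r0) (u u' : Unit) :
    ‖(capSR N q r0)⁻¹ (Sum.inr u) (Sum.inr u')‖ ≤ (π / 2) ^ 4 * ccc D := by
  have hN0 : (0 : ℝ) < N := by exact_mod_cast hN
  have hr := radius_pos hq0 hr0
  have hρ := rad_le hr0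
  have hP := (ccc_pos D).le
  rw [norm_capSR_inv_apply hN hq hq0 hr, colScaleR_inr, rowScaleR_inr]
  have h := norm_cap_inv_inr_inr_le (D := D) (N := N) hN hq hq0 u u'
  rw [← rad_pow_four] at h
  calc (r0 ^ 3 / (N : ℝ) ^ 3)⁻¹ * ‖(cap N (ofRealVec q))⁻¹ (Sum.inr u) (Sum.inr u')‖ * (r0 / (N : ℝ) ^ (D + 1))⁻¹
      ≤ (r0 ^ 3 / (N : ℝ) ^ 3)⁻¹ * (ccc D * rad q ^ 4 / (N : ℝ) ^ (D + 4)) * (r0 / (N : ℝ) ^ (D + 1))⁻¹ :=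
        mul_le_mul_of_nonneg_right (mul_le_mul_of_nonneg_left h (by positivity)) (by positivity)
    _ = ccc D * (rad q / r0) ^ 4 := by field_simp; ring
    _ ≤ ccc D * (π / 2) ^ 4 := by
        apply mul_le_mul_of_nonneg_left _ hP
        exact pow_le_pow_left₀ (div_nonneg (rad_nonneg q) hr.le) (by rw [div_le_iff₀ hr]; exact hρ) 4
    _ = (π / 2) ^ 4 * ccc D := by ring

/-! ## §4 Operator norm; the `radO` instance -/

/-- The displayed constant for a general radius: `bCapO D = (π/2)²D²·cPP D + 2(π/2)³D·cPc D + (π/2)⁴·ccc D`. -/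
def bCapO (D : ℕ) : ℝ := (π / 2) ^ 2 * (D : ℝ) ^ 2 * cPP D + 2 * (π / 2) ^ 3 * D * cPc D + (π / 2) ^ 4 * ccc D

/-- [folklore] `0 < bCapO D`. -/
theorem bCapO_pos (D : ℕ) : 0 < bCapO D := by
  have h1 := cPP_pos D; have h2 := cPc_pos D; have h3 := ccc_pos D; have hπ := Real.pi_pos
  unfold bCapO; positivity

/-- **THE OUTER-SCALED INVERSE CAPACITANCE IS O(1) FOR ANY RADIUS `r₀ ≥ (2/π)|q|₂`**: `‖(capSR N q r₀)⁻¹‖ ≤ bCapO D`, every `N ≥ 1`,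
`q ∈ [−π, π]^D ∖ {0}` (L2 operator norm). [folklore] -/
theorem norm_capSR_inv_le (hN : 1 ≤ N) (hq : ∀ i, |q i| ≤ π) (hq0 : q ≠ 0) (hr0 : 2 / π * rad q ≤ r0) :
    ‖(capSR N q r0)⁻¹‖ ≤ bCapO D := by
  classical
  refine (opNorm_le_sum_entries _).trans ?_
  simp only [Fintype.sum_sum_type, Finset.sum_add_distrib]
  have h11 : ∑ κ : Fin D, ∑ l : Fin D, ‖(capSR N q r0)⁻¹ (Sum.inl κ) (Sum.inl l)‖ ≤ (D : ℝ) ^ 2 * ((π / 2) ^ 2 * cPP D) := by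
    calc ∑ κ : Fin D, ∑ l : Fin D, ‖(capSR N q r0)⁻¹ (Sum.inl κ) (Sum.inl l)‖ ≤ ∑ _κ : Fin D, ∑ _l : Fin D, (π / 2) ^ 2 * cPP D :=
          Finset.sum_le_sum fun κ _ => Finset.sum_le_sum fun l _ => norm_capSR_inv_inl_inl_le hN hq hq0 hr0 κ l
      _ = (D : ℝ) ^ 2 * ((π / 2) ^ 2 * cPP D) := by simp [Finset.sum_const, Finset.card_univ, Fintype.card_fin]; ring
  have h12 : ∑ κ : Fin D, ∑ u : Unit, ‖(capSR N q r0)⁻¹ (Sum.inl κ) (Sum.inr u)‖ ≤ D * ((π / 2) ^ 3 * cPc D) := by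
    calc ∑ κ : Fin D, ∑ u : Unit, ‖(capSR N q r0)⁻¹ (Sum.inl κ) (Sum.inr u)‖ ≤ ∑ _κ : Fin D, ∑ _u : Unit, (π / 2) ^ 3 * cPc D :=
          Finset.sum_le_sum fun κ _ => Finset.sum_le_sum fun u _ => norm_capSR_inv_inl_inr_le hN hq hq0 hr0 κ u
      _ = D * ((π / 2) ^ 3 * cPc D) := by simp [Finset.sum_const, Finset.card_univ, Fintype.card_fin]
  have h21 : ∑ u : Unit, ∑ l : Fin D, ‖(capSR N q r0)⁻¹ (Sum.inr u) (Sum.inl l)‖ ≤ D * ((π / 2) ^ 3 * cPc D) := by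
    calc ∑ u : Unit, ∑ l : Fin D, ‖(capSR N q r0)⁻¹ (Sum.inr u) (Sum.inl l)‖ ≤ ∑ _u : Unit, ∑ _l : Fin D, (π / 2) ^ 3 * cPc D :=
          Finset.sum_le_sum fun u _ => Finset.sum_le_sum fun l _ => norm_capSR_inv_inr_inl_le hN hq hq0 hr0 u l
      _ = D * ((π / 2) ^ 3 * cPc D) := by simp [Finset.sum_const, Finset.card_univ, Fintype.card_fin]
  have h22 : ∑ u : Unit, ∑ u' : Unit, ‖(capSR N q r0)⁻¹ (Sum.inr u) (Sum.inr u')‖ ≤ (π / 2) ^ 4 * ccc D := by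
    calc ∑ u : Unit, ∑ u' : Unit, ‖(capSR N q r0)⁻¹ (Sum.inr u) (Sum.inr u')‖ ≤ ∑ _u : Unit, ∑ _u' : Unit, (π / 2) ^ 4 * ccc D :=
          Finset.sum_le_sum fun u _ => Finset.sum_le_sum fun u' _ => norm_capSR_inv_inr_inr_le hN hq hq0 hr0 u u'
      _ = (π / 2) ^ 4 * ccc D := by simp
  unfold bCapO
  linarith

/-- [folklore] PACKAGED: `IsUnit (capSR N q r₀) ∧ ‖(capSR N q r₀)⁻¹‖ ≤ bCapO D` for `r₀ ≥ (2/π)|q|₂`. -/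
theorem capSR_ape (hN : 1 ≤ N) (hq : ∀ i, |q i| ≤ π) (hq0 : q ≠ 0) (hr0 : 2 / π * rad q ≤ r0) :
    IsUnit (capSR N q r0) ∧ ‖(capSR N q r0)⁻¹‖ ≤ bCapO D :=
  ⟨isUnit_capSR hN hq hq0 (radius_pos hq0 hr0), norm_capSR_inv_le hN hq hq0 hr0⟩

omit [NeZero N] in
/-- [folklore] **F1c's outer radius of the zero alias qualifies**: `(2/π)|q|₂ ≤ N·√(lapR (kfine N q 0))` (= `radO N q 0`), from leaf-12's
`le_sq_mul_lapR_zero` `(4/π²)|q|² ≤ N²·L₀`. -/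
theorem two_div_pi_mul_rad_le_radO (hN : 1 ≤ N) (hq : ∀ i, |q i| ≤ π) :
    2 / π * rad q ≤ (N : ℝ) * Real.sqrt (lapR (kfine N q 0)) := by
  have hN0 : (0 : ℝ) ≤ N := Nat.cast_nonneg N
  have hπ := Real.pi_pos
  have h := le_sq_mul_lapR_zero hN hq
  have e1 : 2 / π * rad q = Real.sqrt (4 / π ^ 2 * momSq q) := by
    rw [Real.sqrt_mul (by positivity), show (4 : ℝ) / π ^ 2 = (2 / π) ^ 2 by ring, Real.sqrt_sq (by positivity)]; rfl
  have e2 : (N : ℝ) * Real.sqrt (lapR (kfine N q 0)) = Real.sqrt ((N : ℝ) ^ 2 * lapR (kfine N q 0)) := by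
    rw [Real.sqrt_mul (by positivity), Real.sqrt_sq hN0]
  rw [e1, e2]
  exact Real.sqrt_le_sqrt h

/-- **THE `radO` INSTANCE** (what F5 proper feeds to `ArrowNorms.isUnit_bordered`): with `r₀ = N·√(lapR (kfine N q 0))`,
`IsUnit (capSR N q r₀) ∧ ‖(capSR N q r₀)⁻¹‖ ≤ bCapO D` for every `N ≥ 1`, `q ∈ [−π, π]^D ∖ {0}`. [folklore] -/
theorem capSR_ape_radO (hN : 1 ≤ N) (hq : ∀ i, |q i| ≤ π) (hq0 : q ≠ 0) :
    IsUnit (capSR N q ((N : ℝ) * Real.sqrt (lapR (kfine N q 0)))) ∧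
      ‖(capSR N q ((N : ℝ) * Real.sqrt (lapR (kfine N q 0))))⁻¹‖ ≤ bCapO D :=
  capSR_ape hN hq hq0 (two_div_pi_mul_rad_le_radO hN hq)

end Summit.QuantumFields.BalabanUV.Beta.GAN24.ArrowAnchorRealCapRadius

end
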